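import Mathlib
import Literature.Analysis.FluidPDE.ClassicalSolution
import Literature.Analysis.FluidPDE.LerayHopf
import Literature.Analysis.FluidPDE.NSWave0
import Summits.NavierStokesRegularity.NavierStokesRegularity.Theses.L3TimeExponentPincer
import Summits.NavierStokesRegularity.NavierStokesRegularity.Theorems.L3TimeExponentPincerPaceDichotomy
import Summits.NavierStokesRegularity.NavierStokesRegularity.Theorems.L3TimeExponentPincerL3BiteMorreyRate
import HarnessLib

/-!
# `EffSatBlowup` (stmt-19139, the registered stub `stub_effSaturation_blowup` of line `effsat` of the
# parent crux `L3CascadeJaw`, stmt-19499): the effective speed `U` can be taken minimal, `U = ‖u(t)‖₃³`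

Support file for the parent crux `L3CascadeJaw` / its hard stub = the child crux `EffSatBlowup`
(cell ns-regularity-ideate, seat ns-pincer-19499-p1).  The `K₃(1)` clause `FatClauseAt m R₀ L u T t`
(p2's `PaceDichotomy`) asks for SOME effective speed `U ≥ 0` with `‖u(t)‖₃³ ≤ L U` and a ball of radius
`r ≥ R₀ U (T-t)` holding energy `≥ m U² r³`.  Both requirements on the ball are MONOTONE in `U` (larger `U`
forces a larger radius and a larger energy), so the clause holds iff it holds with the SMALLEST admissible
speed `U₀ = ‖u(t)‖₃³ / L`; after rescaling the constants (`κ = R₀/L`, `m' = m/L²`) the auxiliary `U` and the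
constant `L` disappear:

* `fatClauseAt_of_l3Speed`, `l3Speed_of_fatClauseAt` — the two directions at one time (the second for
  `t ≤ T`, `m, R₀ ≥ 0`, `L > 0`; the first needs `‖u(t)‖₃ < ∞`, true on `[0,T)` for frame solutions);
* `effSatNear_iff_l3Speed` — for a frame solution, `EffSatNear u T ↔ ∃ m κ > 0, ∃ T₁ < T, ∀ t ∈ (T₁,T),
  ∃ x₀ r, κ ‖u(t)‖₃³ (T-t) ≤ r ∧ m ‖u(t)‖₃⁶ r³ ≤ ∫_{B(x₀,r)} |u(t)|²`;
* **`effSatBlowup_iff_l3Speed`** — the child crux BY NAME in the two-constant, `U`-free form: every frame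
  blow-up carries, at each late time, a ball of radius at least `κ (T-t) ‖u(t)‖₃³` (the causal scale of the
  `L³` speed) whose energy is at least `m ‖u(t)‖₃⁶ r³` (mean energy density `≳ ‖u(t)‖₃⁶`, an
  `‖u‖₃³`-fat ball).

Reading for the line and its disprover: one existential fewer in every stub built on `FatClauseAt`; the
kill shape of `EffSatBlowup` is a frame blow-up and late times at which EVERY ball `B(x₀,r)` with
`r ≥ κ(T-t)‖u(t)‖₃³` has energy `< m ‖u(t)‖₃⁶ r³`, for all `κ, m > 0`.

WHAT THIS IS NOT: not a claim about Navier–Stokes regularity or blow-up; a kernel-checked reformulation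
of the child crux AS TYPED, landed `--supports … --as helper`.
-/

noncomputable section

namespace Summit.NavierStokesRegularity.NavierStokesRegularity.Theorems.L3TimeExponentPincerEffSatMinimalSpeed

open MeasureTheory Set Function Filter Topology Metric
open scoped ENNReal NNReal
open Literature.Analysis.FluidPDE
open Summit.NavierStokesRegularity.NavierStokesRegularity.Theses.L3TimeExponentPincer (EffSatBlowup)
open Summit.NavierStokesRegularity.NavierStokesRegularity.Theorems.L3TimeExponentPincerPaceDichotomy
  (FatClauseAt EffSatNear)
open Summit.NavierStokesRegularity.NavierStokesRegularity.Theorems.L3TimeExponentPincerL3BiteMorreyRate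
  (eLpNorm_three_lt_top_of_frame)

/-! ## One time: the minimal speed -/

/-- **`U`-free ⇒ `FatClauseAt`** with `U = ‖u(t)‖₃³ / L`: if `‖u(t)‖₃ < ∞`, `L > 0`, and some ball of
radius `r ≥ R₀ (‖u(t)‖₃³/L) (T-t)` holds energy `≥ m (‖u(t)‖₃³/L)² r³`, then `FatClauseAt m R₀ L u T t`.
[folklore] -/
theorem fatClauseAt_of_l3Speed {m R₀ L : ℝ} (hL : 0 < L)
    {u : ℝ → EuclideanSpace ℝ (Fin 3) → EuclideanSpace ℝ (Fin 3)} {T t : ℝ}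
    (hfin : eLpNorm (u t) 3 volume < ⊤)
    (h : ∃ x₀ : EuclideanSpace ℝ (Fin 3), ∃ r : ℝ,
      R₀ * ((eLpNorm (u t) 3 volume ^ (3 : ℝ)).toReal / L) * (T - t) ≤ r ∧
        ENNReal.ofReal (m * (((eLpNorm (u t) 3 volume ^ (3 : ℝ)).toReal / L) ^ 2 * r ^ 3)) ≤
          ∫⁻ x in ball x₀ r, ‖u t x‖ₑ ^ 2) :
    FatClauseAt m R₀ L u T t := by
  obtain ⟨x₀, r, hr, hE⟩ := h
  have h3top : eLpNorm (u t) 3 volume ^ (3 : ℝ) ≠ ⊤ :=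
    ENNReal.rpow_ne_top_of_nonneg (by norm_num) hfin.ne
  refine ⟨(eLpNorm (u t) 3 volume ^ (3 : ℝ)).toReal / L, div_nonneg ENNReal.toReal_nonneg hL.le, ?_,
    x₀, r, hr, hE⟩
  rw [mul_div_cancel₀ _ hL.ne', ENNReal.ofReal_toReal h3top]

/-- **`FatClauseAt` ⇒ `U`-free** with the minimal speed: for `t ≤ T`, `m, R₀ ≥ 0`, `L > 0`, the clause with
ANY admissible `U` gives the clause with `U₀ = ‖u(t)‖₃³/L ≤ U` (radius and energy requirements are
monotone in `U`). [folklore] -/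
theorem l3Speed_of_fatClauseAt {m R₀ L : ℝ} (hm : 0 ≤ m) (hR₀ : 0 ≤ R₀) (hL : 0 < L)
    {u : ℝ → EuclideanSpace ℝ (Fin 3) → EuclideanSpace ℝ (Fin 3)} {T t : ℝ} (ht : t ≤ T)
    (h : FatClauseAt m R₀ L u T t) :
    ∃ x₀ : EuclideanSpace ℝ (Fin 3), ∃ r : ℝ,
      R₀ * ((eLpNorm (u t) 3 volume ^ (3 : ℝ)).toReal / L) * (T - t) ≤ r ∧
        ENNReal.ofReal (m * (((eLpNorm (u t) 3 volume ^ (3 : ℝ)).toReal / L) ^ 2 * r ^ 3)) ≤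
          ∫⁻ x in ball x₀ r, ‖u t x‖ₑ ^ 2 := by
  obtain ⟨U, hU0, hU, x₀, r, hr, hE⟩ := h
  set U₀ : ℝ := (eLpNorm (u t) 3 volume ^ (3 : ℝ)).toReal / L with hU₀
  have hU₀0 : 0 ≤ U₀ := div_nonneg ENNReal.toReal_nonneg hL.le
  have hU₀U : U₀ ≤ U := by
    rw [hU₀, div_le_iff₀ hL, mul_comm]
    exact ENNReal.toReal_le_of_le_ofReal (mul_nonneg hL.le hU0) hU
  refine ⟨x₀, r, ?_, ?_⟩
  · calc R₀ * U₀ * (T - t) ≤ R₀ * U * (T - t) := by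
          have hTt : 0 ≤ T - t := sub_nonneg.2 ht
          exact mul_le_mul_of_nonneg_right (mul_le_mul_of_nonneg_left hU₀U hR₀) hTt
      _ ≤ r := hr
  · rcases le_or_gt r 0 with hr0 | hr0
    · -- degenerate radius: the left side is `ofReal` of a nonpositive number
      have hnp : m * (U₀ ^ 2 * r ^ 3) ≤ 0 := by
        have : r ^ 3 ≤ 0 := by
          rw [pow_succ]
          exact mul_nonpos_of_nonneg_of_nonpos (sq_nonneg r) hr0
        exact mul_nonpos_of_nonneg_of_nonpos hm (mul_nonpos_of_nonneg_of_nonpos (sq_nonneg _) this)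
      rw [ENNReal.ofReal_of_nonpos hnp]
      exact bot_le
    · calc ENNReal.ofReal (m * (U₀ ^ 2 * r ^ 3)) ≤ ENNReal.ofReal (m * (U ^ 2 * r ^ 3)) := by
            refine ENNReal.ofReal_le_ofReal (mul_le_mul_of_nonneg_left ?_ hm)
            exact mul_le_mul_of_nonneg_right (pow_le_pow_left₀ hU₀0 hU₀U 2) (pow_nonneg hr0.le 3)
        _ ≤ ∫⁻ x in ball x₀ r, ‖u t x‖ₑ ^ 2 := hE

/-! ## Near `T`: `EffSatNear` in the `U`-free, two-constant form -/

/-- **`EffSatNear` for a frame solution ↔ the `U`-free two-constant form**: there are `m, κ > 0` and a final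
window on which, at each time, some ball of radius `r ≥ κ ‖u(t)‖₃³ (T-t)` holds energy
`≥ m ‖u(t)‖₃⁶ r³`. (⇒) minimal speed with `κ = R₀/L`, `m' = m/L²`; (⇐) `L = 1`, `U = ‖u(t)‖₃³`
(finite on `[0,T)` for frame solutions, `eLpNorm_three_lt_top_of_frame`); windows are shrunk into
`(0,T)` where needed. [folklore] -/
theorem effSatNear_iff_l3Speed {ν T : ℝ} (hν : 0 < ν) (hT : 0 < T)
    {u : ℝ → EuclideanSpace ℝ (Fin 3) → EuclideanSpace ℝ (Fin 3)} {p : ℝ → EuclideanSpace ℝ (Fin 3) → ℝ}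
    (hcl : IsClassicalNSSolutionOn (Ico 0 T) ν 0 u p) (hLH : IsLerayHopfOn T ν 0 (u 0) u)
    (hdec : HasRapidSpatialDecay (u 0)) :
    EffSatNear u T ↔
      ∃ m : ℝ, 0 < m ∧ ∃ κ : ℝ, 0 < κ ∧ ∃ T₁ < T, ∀ t ∈ Ioo T₁ T,
        ∃ x₀ : EuclideanSpace ℝ (Fin 3), ∃ r : ℝ,
          κ * (eLpNorm (u t) 3 volume ^ (3 : ℝ)).toReal * (T - t) ≤ r ∧
            ENNReal.ofReal (m * ((eLpNorm (u t) 3 volume ^ (3 : ℝ)).toReal ^ 2 * r ^ 3)) ≤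
              ∫⁻ x in ball x₀ r, ‖u t x‖ₑ ^ 2 := by
  constructor
  · rintro ⟨m, hm, R₀, hR₀, L, hL, T₁, hT₁T, hfat⟩
    refine ⟨m / L ^ 2, by positivity, R₀ / L, by positivity, T₁, hT₁T, fun t ht => ?_⟩
    obtain ⟨x₀, r, hr, hE⟩ := l3Speed_of_fatClauseAt hm.le hR₀.le hL ht.2.le (hfat t ht)
    refine ⟨x₀, r, ?_, ?_⟩
    · have e : R₀ / L * (eLpNorm (u t) 3 volume ^ (3 : ℝ)).toReal * (T - t) =
          R₀ * ((eLpNorm (u t) 3 volume ^ (3 : ℝ)).toReal / L) * (T - t) := by ring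
      rw [e]; exact hr
    · have e : m / L ^ 2 * ((eLpNorm (u t) 3 volume ^ (3 : ℝ)).toReal ^ 2 * r ^ 3) =
          m * (((eLpNorm (u t) 3 volume ^ (3 : ℝ)).toReal / L) ^ 2 * r ^ 3) := by
        field_simp
      rw [e]; exact hE
  · rintro ⟨m, hm, κ, hκ, T₁, hT₁T, h⟩
    refine ⟨m, hm, κ, hκ, 1, one_pos, max T₁ 0, max_lt hT₁T hT, fun t ht => ?_⟩
    have ht0 : t ∈ Ico 0 T := ⟨(le_max_right T₁ 0).trans ht.1.le, ht.2⟩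
    have ht₁ : t ∈ Ioo T₁ T := ⟨lt_of_le_of_lt (le_max_left _ _) ht.1, ht.2⟩
    obtain ⟨x₀, r, hr, hE⟩ := h t ht₁
    refine fatClauseAt_of_l3Speed one_pos (eLpNorm_three_lt_top_of_frame hν hcl hLH hdec ht0)
      ⟨x₀, r, ?_, ?_⟩
    · simpa only [div_one] using hr
    · simpa only [div_one] using hE

/-! ## The child crux by name -/

/-- **`EffSatBlowup` ↔ its `U`-free two-constant form.**  The child crux (stmt-NavierStokesRegularity-19139,
the registered hard stub `stub_effSaturation_blowup` of line `effsat` of the parent `L3CascadeJaw`) says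
exactly: every frame blow-up has `m, κ > 0` and a final window on which, at every time, SOME ball of
radius at least `κ (T-t) ‖u(t)‖₃³` — the causal scale of the `L³` speed — carries energy at least
`m ‖u(t)‖₃⁶ r³`.  The auxiliary speed `U` and the constant `L` of the route's text are inessential
(`U = ‖u(t)‖₃³`, `L = 1` without loss). [folklore] -/
theorem effSatBlowup_iff_l3Speed :
    EffSatBlowup ↔
      ∀ (ν T : ℝ), 0 < ν → 0 < T →
        ∀ (u : ℝ → EuclideanSpace ℝ (Fin 3) → EuclideanSpace ℝ (Fin 3)) (p : ℝ → EuclideanSpace ℝ (Fin 3) → ℝ),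
          IsClassicalNSSolutionOn (Ico 0 T) ν 0 u p → IsLerayHopfOn T ν 0 (u 0) u →
          HasRapidSpatialDecay (u 0) → ¬ HasSmoothExtensionPast ν 0 u T →
          ∃ m : ℝ, 0 < m ∧ ∃ κ : ℝ, 0 < κ ∧ ∃ T₁ < T, ∀ t ∈ Ioo T₁ T,
            ∃ x₀ : EuclideanSpace ℝ (Fin 3), ∃ r : ℝ,
              κ * (eLpNorm (u t) 3 volume ^ (3 : ℝ)).toReal * (T - t) ≤ r ∧
                ENNReal.ofReal (m * ((eLpNorm (u t) 3 volume ^ (3 : ℝ)).toReal ^ 2 * r ^ 3)) ≤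
                  ∫⁻ x in ball x₀ r, ‖u t x‖ₑ ^ 2 := by
  -- the route decl is the verbatim twin of the node `L3TimeExponentPincerEffNode.EffSatBlowup`, whose
  -- unfolding `effSatBlowup_iff` is `Iff.rfl`; both sides below are matched definitionally
  constructor
  · intro h ν T hν hT u p hcl hLH hdec hmax
    have h' : EffSatNear u T := h ν T hν hT u p hcl hLH hdec hmax
    exact (effSatNear_iff_l3Speed hν hT hcl hLH hdec).1 h'
  · intro h ν T hν hT u p hcl hLH hdec hmax
    have h' : EffSatNear u T := (effSatNear_iff_l3Speed hν hT hcl hLH hdec).2 (h ν T hν hT u p hcl hLH hdec hmax)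
    exact h'

end Summit.NavierStokesRegularity.NavierStokesRegularity.Theorems.L3TimeExponentPincerEffSatMinimalSpeed

end
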